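import Summits.NavierStokesRegularity.NavierStokesRegularity.Theorems.ScenarioCensusRowF1EchoTopKill
import HarnessLib

/-!
# LINE 39 «echo-top» port, part 3/3: §5 the FLOORS proved (`echoFloor_holds`, `pointEchoFloor_holds`), the census rows as corollaries (`rowF1ep_holds`, `rowF1ew_holds`), the thresholds
# `echoLevel` / `pointEchoLevel` and the floors read pointwise; §6 residual `EchoCollapse` ≡ `Row_F1`, what the hypotheses admit (steady / periodic / travelling / rest-window
# examples); §7 summary; census KEYS `Row_F1ep` / `Row_F1ew` + `_excluded`, floors EF / PEF

Re-homed for the scenario census (typer seat ns-census-typer-1 g10; the cells F1ep / F1ew and the floors EF / PEF are MEMBERS OF RECORD «DECIDED IN KERNEL IN FILES» of row F1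
(item 82: critic idea-crit-3 g10 PASS 11:46:18Z; ref ns-census-ref g14 PRE-CHECK ✓ §19.6; lead label); this port makes them TREE-decided): VERBATIM PORT of ns-idea-3 LINE 39
«echo-top», `pub/ideators/ns-idea-3/lines/echo-top/line-echo-top.lean` sha16 2e8e6517bab89429 (1057 l., lean check rc 0, 0 sorry), split for the 400-line rule into
`ScenarioCensusRowF1EchoTop` (§1–§3) → `…EchoTopKill` (§4) → `…EchoTopRows` (§5–§7 + census KEYS).  Lean text VERBATIM in namespace `…Theorems.ScenarioCensus.EchoTop` (the
line's `…Cruxes.ScenarioCensusRowF1.EchoTopLine` re-homed); port edits: the frame restated VERBATIM by the line from LINES 34–38 (`topSet`, `HasTypeIConstant`, `snapLevel`,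
`exists_fast_at`, `sqrt_mul_sq_mul`, `pocket_limit`, `limitClass_compact`, `exists_level_of_limitKill`, `zoom_units`) is taken BY NAME from the landed two-time-top / one-level-top /
snapshot-top / needle-top ports; `@[conjecture]` on the residual `EchoCollapse` (≡ `ScenarioCensus.Row_F1`, OPEN); one-line docstrings added where missing (gate lint).  Statements
untouched.

No census VALUE is moved here (row F1 stays OPEN-WITH-LINE; the members become TREE-decided by name); NS regularity is NOT proved; `Row_F1` is untouched (zero
movement, `echoCollapse_iff_rowF1`); no summit statement is proved by this file. Lemmas that restate already-landed tree declarations are taken BY NAME (gate lint `dedup.landed`): `topSet` = `TwoTimeTop.topSet`, `HasTypeIConstant` = `OneLevelTop.HasTypeIConstant`, `snapLevel` = `SnapshotTop.snapLevel`, `exists_fast_at` = `SnapshotTop.exists_fast_at`, `sqrt_mul_sq_mul` = `SnapshotTop.sqrt_mul_sq_mul`, `pocket_limit` = `SnapshotTop.pocket_limit`, `limitClass_compact` = `NeedleTop.limitClass_compact`, `exists_level_of_limitKill` = `NeedleTop.exists_level_of_limitKill`, `zoom_units` = `NeedleTop.zoom_units`.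
-/

-- the summit and its single problem share the name `NavierStokesRegularity` (D-0017 nested layout)
set_option linter.dupNamespace false

noncomputable section

open MeasureTheory Set Function Filter TopologicalSpace Metric
open scoped Topology NNReal ENNReal InnerProductSpace

namespace Summit.NavierStokesRegularity.NavierStokesRegularity.Theorems.ScenarioCensus.EchoTop

open Literature.Analysis Literature.Analysis.FluidPDE
open Summit.NavierStokesRegularity.NavierStokesRegularity.Theorems
open Summit.NavierStokesRegularity.NavierStokesRegularity.Theses
open Summit.NavierStokesRegularity.NavierStokesRegularity.Theorems.LocalHelicityTubeDoorFrobeniusProfileRigidityHelicalSlice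

/-! ## §5 THE FLOORS (universal over fast points, every level), proved; the census ROWS as corollaries (Leray's every-time floor);
definite thresholds; the residual ≡ row F1 -/

-- `zoom_units`: the line restates the tree's `NeedleTop.zoom_units`; taken BY NAME (gate lint dedup.landed).

/-- `∀ᶠ t, ∀ x ∈ S t, ¬ E t x` from the impossibility of `∃ᶠ t, ∃ x ∈ S t, E t x` (filter bookkeeping). -/
theorem eventually_forall_not_of_not_frequently {T : ℝ} {S : ℝ → Set E3} {E : ℝ → E3 → Prop}
    (h : ¬ ∃ᶠ t in 𝓝[<] T, ∃ x ∈ S t, E t x) : ∀ᶠ t in 𝓝[<] T, ∀ x ∈ S t, ¬ E t x := by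
  rw [not_frequently] at h
  filter_upwards [h] with t ht x hx hE
  exact ht ⟨x, hx, hE⟩

/-- **THE ECHO FLOOR holds** (witness package of §3 + echo level of §4). -/
theorem echoFloor_holds : EchoFloor := by
  intro M Λ θ A a d hΛ hθ hnd ha
  obtain ⟨Λ₁, hΛ₁, hlev⟩ := exists_echoLevel M θ A a d hθ hnd ha hΛ
  refine ⟨Λ₁, hΛ₁, ?_⟩
  intro ν T hν hT u p hsol hLH hdec hM
  refine eventually_forall_not_of_not_frequently fun hfreq => ?_
  obtain ⟨c, x, W, hcpos, -, hW, hQ, -, hconv, -, -, hnorm⟩ :=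
    exists_witnessZoom_package hν hT hsol hLH hdec hM hfreq
  apply hlev W hW hnorm
  -- the echo pocket at `(t_j, x_j)` read in the zoom: `‖Z_j(−1, y) − Z_j(−1 − θ, y + d)‖ ≤ Λ₁` on `closedBall ζ_j a`, `ζ_j ∈ closedBall 0 A`
  have hpk : ∀ j, ∃ ζ : E3, ζ ∈ closedBall (0 : E3) A ∧ ∀ y ∈ closedBall ζ a,
      ‖(c j * 1) • u (T + c j ^ 2 * ν * (-1)) (x j + (c j * ν) • y)
        - (c j * 1) • u (T + c j ^ 2 * ν * (-1 - θ)) (x j + (c j * ν) • (y + d))‖ ≤ Λ₁ := by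
    intro j
    obtain ⟨hunit, hsq⟩ := NeedleTop.zoom_units (T := T) hν hcpos j
    obtain ⟨z, hzx, hcalm⟩ := hQ j
    have hcν : 0 < c j * ν := mul_pos (hcpos j) hν
    refine ⟨(c j * ν)⁻¹ • (z - x j), ?_, fun y hy => ?_⟩
    · rw [mem_closedBall, dist_zero_right, norm_smul, norm_inv, Real.norm_eq_abs, abs_of_pos hcν,
        inv_mul_le_iff₀ hcν]
      rw [hunit] at hzx
      linarith
    · have hx' : ‖x j + (c j * ν) • y - z‖ ≤ a * Real.sqrt (ν * (T - (T + c j ^ 2 * ν * (-1)))) := by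
        rw [hunit]
        have e : x j + (c j * ν) • y - z = (c j * ν) • (y - (c j * ν)⁻¹ • (z - x j)) := by
          rw [smul_sub, smul_smul, mul_inv_cancel₀ hcν.ne', one_smul]
          abel
        rw [e, norm_smul, Real.norm_eq_abs, abs_of_pos hcν]
        rw [mem_closedBall, dist_eq_norm] at hy
        nlinarith
      have h1 := hcalm _ hx'
      have etime : T + c j ^ 2 * ν * (-1) - θ * (T - (T + c j ^ 2 * ν * (-1))) = T + c j ^ 2 * ν * (-1 - θ) := by ring
      have ept : x j + (c j * ν) • y + (c j * ν) • d = x j + (c j * ν) • (y + d) := by rw [smul_add, add_assoc]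
      rw [hsq, hunit, etime, ept] at h1
      rw [← smul_sub, norm_smul, Real.norm_eq_abs, abs_of_pos (mul_pos (hcpos j) one_pos), mul_one]
      set D : ℝ := ‖u (T + c j ^ 2 * ν * (-1)) (x j + (c j * ν) • y)
        - u (T + c j ^ 2 * ν * (-1 - θ)) (x j + (c j * ν) • (y + d))‖ with hD
      have h2 : c j * D * Real.sqrt ν ≤ Λ₁ * Real.sqrt ν := by
        linarith [h1, mul_comm (Real.sqrt ν) D, mul_assoc (c j) (Real.sqrt ν) D]
      exact le_of_mul_le_mul_right h2 (Real.sqrt_pos.2 hν)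
  choose ζ hζ hcalmζ using hpk
  have h1θ : (-1 : ℝ) - θ < 0 := by linarith
  obtain ⟨ζ₀, hζ₀, hlim⟩ := SnapshotTop.pocket_limit
    (f := fun j y => (c j * 1) • u (T + c j ^ 2 * ν * (-1)) (x j + (c j * ν) • y)
        - (c j * 1) • u (T + c j ^ 2 * ν * (-1 - θ)) (x j + (c j * ν) • (y + d)))
    (g := fun y => W (-1) y - W (-1 - θ) (y + d)) ha hζ (tendsto_const_nhds (x := Λ₁))
    (fun y => (hconv (-1) (by norm_num) y).sub (hconv (-1 - θ) h1θ (y + d))) hcalmζ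
  exact ⟨ζ₀, hζ₀, hlim⟩

/-- **THE POINT-ECHO FLOOR holds** (witness package + point-echo level; pointwise convergence at the two fixed points `(s, 0)`, `(s − θ, 0)`). -/
theorem pointEchoFloor_holds : PointEchoFloor := by
  intro M Λ θ δ hΛ hθ hδ
  obtain ⟨Λ₁, hΛ₁, hlev⟩ := exists_pointEchoLevel M θ δ hθ hδ hΛ
  refine ⟨Λ₁, hΛ₁, ?_⟩
  intro ν T hν hT u p hsol hLH hdec hM
  refine eventually_forall_not_of_not_frequently fun hfreq => ?_
  obtain ⟨c, x, W, hcpos, -, hW, hQ, -, hconv, -, -, hnorm⟩ :=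
    exists_witnessZoom_package hν hT hsol hLH hdec hM hfreq
  apply hlev W hW hnorm
  intro s hs
  have hs0 : s < 0 := by linarith [hs.2]
  have hsθ : s - θ < 0 := by linarith
  -- the point echo at `(t_j, x_j)` read in the zoom at the times `s`, `s − θ`
  have hpk : ∀ j, ‖(c j * 1) • u (T + c j ^ 2 * ν * s) (x j + (c j * ν) • (0 : E3))
      - (c j * 1) • u (T + c j ^ 2 * ν * (s - θ)) (x j + (c j * ν) • (0 : E3))‖ ≤ Λ₁ := by
    intro j
    obtain ⟨hunit, hsq⟩ := NeedleTop.zoom_units (T := T) hν hcpos j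
    have hc2 : 0 < c j ^ 2 * ν := mul_pos (pow_pos (hcpos j) 2) hν
    have hτ : T + c j ^ 2 * ν * s ∈ Icc (T + c j ^ 2 * ν * (-1) - δ * (T - (T + c j ^ 2 * ν * (-1)))) (T + c j ^ 2 * ν * (-1)) := by
      constructor
      · nlinarith [hs.1]
      · nlinarith [hs.2]
    have h1 := hQ j _ hτ
    have etime : T + c j ^ 2 * ν * s - θ * (T - (T + c j ^ 2 * ν * (-1))) = T + c j ^ 2 * ν * (s - θ) := by ring
    rw [hsq, etime] at h1
    rw [smul_zero, add_zero, ← smul_sub, norm_smul, Real.norm_eq_abs, abs_of_pos (mul_pos (hcpos j) one_pos), mul_one]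
    set D : ℝ := ‖u (T + c j ^ 2 * ν * s) (x j) - u (T + c j ^ 2 * ν * (s - θ)) (x j)‖ with hD
    have h2 : c j * D * Real.sqrt ν ≤ Λ₁ * Real.sqrt ν := by
      linarith [h1, mul_comm (Real.sqrt ν) D, mul_assoc (c j) (Real.sqrt ν) D]
    exact le_of_mul_le_mul_right h2 (Real.sqrt_pos.2 hν)
  have hlim : Tendsto (fun j => ‖(c j * 1) • u (T + c j ^ 2 * ν * s) (x j + (c j * ν) • (0 : E3))
      - (c j * 1) • u (T + c j ^ 2 * ν * (s - θ)) (x j + (c j * ν) • (0 : E3))‖) atTop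
      (𝓝 ‖W s 0 - W (s - θ) 0‖) := ((hconv s hs0 0).sub (hconv (s - θ) hsθ 0)).norm
  exact le_of_tendsto hlim (Eventually.of_forall hpk)

/-- **ROW F1ep holds** — the census-shaped corollary of the echo floor at Leray's level `c_S`: under NON-extension every instant of
`[0, T)` has a `c_S`-fast point (`SnapshotTop.exists_fast_at`), so «frequently every `c_S`-fast point echoes» meets «eventually no `c_S`-fast point
echoes». -/
theorem rowF1ep_holds : Row_F1ep := by
  intro M θ A a d hθ hnd ha
  obtain ⟨ε, hε, hfl⟩ := echoFloor_holds M SnapshotTop.snapLevel θ A a d SnapshotTop.snapLevel_pos hθ hnd ha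
  refine ⟨ε, hε, fun ν T hν hT u p hsol hLH hdec hM hfreq => ?_⟩
  by_contra hmax
  have hev := hfl ν T hν hT u p hsol hLH hdec hM
  have hIco : ∀ᶠ t in 𝓝[<] T, t ∈ Ico (0 : ℝ) T := Ico_mem_nhdsLT hT
  obtain ⟨t, hall, hnone, htI⟩ := (hfreq.and_eventually (hev.and hIco)).exists
  obtain ⟨x, hx⟩ := SnapshotTop.exists_fast_at hν hT hsol hLH hdec hmax htI
  exact hnone x hx.le (hall x hx.le)

/-- **ROW F1ew holds** (same, from the point-echo floor). -/
theorem rowF1ew_holds : Row_F1ew := by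
  intro M θ δ hθ hδ
  obtain ⟨ε, hε, hfl⟩ := pointEchoFloor_holds M SnapshotTop.snapLevel θ δ SnapshotTop.snapLevel_pos hθ hδ
  refine ⟨ε, hε, fun ν T hν hT u p hsol hLH hdec hM hfreq => ?_⟩
  by_contra hmax
  have hev := hfl ν T hν hT u p hsol hLH hdec hM
  have hIco : ∀ᶠ t in 𝓝[<] T, t ∈ Ico (0 : ℝ) T := Ico_mem_nhdsLT hT
  obtain ⟨t, hall, hnone, htI⟩ := (hfreq.and_eventually (hev.and hIco)).exists
  obtain ⟨x, hx⟩ := SnapshotTop.exists_fast_at hν hT hsol hLH hdec hmax htI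
  exact hnone x hx.le (hall x hx.le)

/-- **The definite echo threshold `echoLevel M Λ θ d A a`** — a witness of the floor (ineffective: compactness); `1` off the admissible
parameter range. -/
def echoLevel (M Λ θ : ℝ) (d : E3) (A a : ℝ) : ℝ :=
  if h : 0 < Λ ∧ 0 ≤ θ ∧ (0 < θ ∨ d ≠ 0) ∧ 0 < a then Classical.choose (echoFloor_holds M Λ θ A a d h.1 h.2.1 h.2.2.1 h.2.2.2) else 1

/-- The definite echo threshold is positive. -/
theorem echoLevel_pos (M Λ θ : ℝ) (d : E3) (A a : ℝ) : 0 < echoLevel M Λ θ d A a := by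
  unfold echoLevel
  split_ifs with h
  · exact (Classical.choose_spec (echoFloor_holds M Λ θ A a d h.1 h.2.1 h.2.2.1 h.2.2.2)).1
  · exact one_pos

/-- **THE ECHO FLOOR, read out at its definite threshold**: in a Clay solution with Type-I constant `M`, for all late instants `t`, EVERY
`Λ`-fast point `x` and EVERY candidate pocket (closed ball of radius `aℓ` centred within `Aℓ` of `x`) contain a point `y` at which the flow
FAILS to repeat its displaced past: `√(T − t)‖u(t, y) − u(t − θ(T − t), y + ℓd)‖ > echoLevel · √ν`. -/
theorem echoFloor_read {M Λ θ A a : ℝ} {d : E3} (hΛ : 0 < Λ) (hθ : 0 ≤ θ) (hnd : 0 < θ ∨ d ≠ 0) (ha : 0 < a)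
    {ν T : ℝ} (hν : 0 < ν) (hT : 0 < T) {u : ℝ → E3 → E3} {p : ℝ → E3 → ℝ}
    (hsol : IsClassicalNSSolutionOn (Ico 0 T) ν 0 u p) (hLH : IsLerayHopfOn T ν 0 (u 0) u)
    (hdec : HasRapidSpatialDecay (u 0)) (hM : OneLevelTop.HasTypeIConstant ν T M u) :
    ∀ᶠ t in 𝓝[<] T, ∀ x ∈ TwoTimeTop.topSet ν T u Λ t, ∀ z : E3, ‖z - x‖ ≤ A * Real.sqrt (ν * (T - t)) →
      ∃ y : E3, ‖y - z‖ ≤ a * Real.sqrt (ν * (T - t)) ∧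
        echoLevel M Λ θ d A a * Real.sqrt ν <
          Real.sqrt (T - t) * ‖u t y - u (t - θ * (T - t)) (y + (Real.sqrt (ν * (T - t))) • d)‖ := by
  have h : 0 < Λ ∧ 0 ≤ θ ∧ (0 < θ ∨ d ≠ 0) ∧ 0 < a := ⟨hΛ, hθ, hnd, ha⟩
  have hspec := (Classical.choose_spec (echoFloor_holds M Λ θ A a d h.1 h.2.1 h.2.2.1 h.2.2.2)).2
    ν T hν hT u p hsol hLH hdec hM
  have hlev : echoLevel M Λ θ d A a = Classical.choose (echoFloor_holds M Λ θ A a d h.1 h.2.1 h.2.2.1 h.2.2.2) := by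
    unfold echoLevel
    rw [dif_pos h]
  filter_upwards [hspec] with t ht x hx z hz
  by_contra hno
  push Not at hno
  exact ht x hx ⟨z, hz, fun y hy => by have h' := hno y hy; rwa [hlev] at h'⟩

/-- **The definite point-echo threshold** and its read-out: eventually EVERY `Λ`-fast point `x` has, within the window
`[t − δ(T − t), t]`, an instant `τ` at which `√(T − t)‖u(τ, x) − u(τ − θ(T − t), x)‖ > pointEchoLevel · √ν`. -/
def pointEchoLevel (M Λ θ δ : ℝ) : ℝ :=
  if h : 0 < Λ ∧ 0 < θ ∧ 0 < δ then Classical.choose (pointEchoFloor_holds M Λ θ δ h.1 h.2.1 h.2.2) else 1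

/-- The definite point-echo threshold is positive. -/
theorem pointEchoLevel_pos (M Λ θ δ : ℝ) : 0 < pointEchoLevel M Λ θ δ := by
  unfold pointEchoLevel
  split_ifs with h
  · exact (Classical.choose_spec (pointEchoFloor_holds M Λ θ δ h.1 h.2.1 h.2.2)).1
  · exact one_pos

/-- The point-echo floor read pointwise. -/
theorem pointEchoFloor_read {M Λ θ δ : ℝ} (hΛ : 0 < Λ) (hθ : 0 < θ) (hδ : 0 < δ)
    {ν T : ℝ} (hν : 0 < ν) (hT : 0 < T) {u : ℝ → E3 → E3} {p : ℝ → E3 → ℝ}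
    (hsol : IsClassicalNSSolutionOn (Ico 0 T) ν 0 u p) (hLH : IsLerayHopfOn T ν 0 (u 0) u)
    (hdec : HasRapidSpatialDecay (u 0)) (hM : OneLevelTop.HasTypeIConstant ν T M u) :
    ∀ᶠ t in 𝓝[<] T, ∀ x ∈ TwoTimeTop.topSet ν T u Λ t, ∃ τ ∈ Icc (t - δ * (T - t)) t,
      pointEchoLevel M Λ θ δ * Real.sqrt ν < Real.sqrt (T - t) * ‖u τ x - u (τ - θ * (T - t)) x‖ := by
  have h : 0 < Λ ∧ 0 < θ ∧ 0 < δ := ⟨hΛ, hθ, hδ⟩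
  have hspec := (Classical.choose_spec (pointEchoFloor_holds M Λ θ δ h.1 h.2.1 h.2.2)).2 ν T hν hT u p hsol hLH hdec hM
  have hlev : pointEchoLevel M Λ θ δ = Classical.choose (pointEchoFloor_holds M Λ θ δ h.1 h.2.1 h.2.2) := by
    unfold pointEchoLevel
    rw [dif_pos h]
  filter_upwards [hspec] with t ht x hx
  by_contra hno
  push Not at hno
  exact ht x hx fun τ hτ => by have h' := hno τ hτ; rwa [hlev] at h'

/-! ## §6 The residual ≡ row F1 (declared); what the hypotheses admit (no smallness anywhere); the rest-window corollary; summary -/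

/-- The census-row threshold `rowLevel M θ d A a := echoLevel M c_S θ d A a`. -/
theorem echoLevel_spec {M θ A a : ℝ} {d : E3} (hθ : 0 ≤ θ) (hnd : 0 < θ ∨ d ≠ 0) (ha : 0 < a)
    (ν T : ℝ) (hν : 0 < ν) (hT : 0 < T) (u : ℝ → E3 → E3) (p : ℝ → E3 → ℝ)
    (hsol : IsClassicalNSSolutionOn (Ico 0 T) ν 0 u p) (hLH : IsLerayHopfOn T ν 0 (u 0) u)
    (hdec : HasRapidSpatialDecay (u 0)) (hM : OneLevelTop.HasTypeIConstant ν T M u)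
    (hfreq : ∃ᶠ t in 𝓝[<] T, ∀ x ∈ TwoTimeTop.topSet ν T u SnapshotTop.snapLevel t, EchoPocketAt ν T u θ d A a (echoLevel M SnapshotTop.snapLevel θ d A a) t x) :
    HasSmoothExtensionPast ν 0 u T := by
  have h : 0 < SnapshotTop.snapLevel ∧ 0 ≤ θ ∧ (0 < θ ∨ d ≠ 0) ∧ 0 < a := ⟨SnapshotTop.snapLevel_pos, hθ, hnd, ha⟩
  have hspec := (Classical.choose_spec (echoFloor_holds M SnapshotTop.snapLevel θ A a d h.1 h.2.1 h.2.2.1 h.2.2.2)).2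
    ν T hν hT u p hsol hLH hdec hM
  have hlev : echoLevel M SnapshotTop.snapLevel θ d A a =
      Classical.choose (echoFloor_holds M SnapshotTop.snapLevel θ A a d h.1 h.2.1 h.2.2.1 h.2.2.2) := by
    unfold echoLevel
    rw [dif_pos h]
  rw [hlev] at hfreq
  by_contra hmax
  have hIco : ∀ᶠ t in 𝓝[<] T, t ∈ Ico (0 : ℝ) T := Ico_mem_nhdsLT hT
  obtain ⟨t, hall, hnone, htI⟩ := (hfreq.and_eventually (hspec.and hIco)).exists
  obtain ⟨x, hx⟩ := SnapshotTop.exists_fast_at hν hT hsol hLH hdec hmax htI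
  exact hnone x hx.le (hall x hx.le)

/-- **Residual «ECHO COLLAPSE»** (maximal frame): every maximal Type-I Clay blow-up with constant `M` admits, for SOME admissible
`(θ, d, A, a)`, echo-pocket snapshots at the threshold `echoLevel M c_S θ d A a` at every `c_S`-fast point along some `t_k ↑ T`.  DECLARED
≡ row F1 (`echoCollapse_iff_rowF1`); no movement on `Row_F1` is claimed — after the floor its content is «there is no Type-I Clay blow-up». -/
@[conjecture] def EchoCollapse : Prop :=
  ∀ (ν T : ℝ), 0 < ν → 0 < T → ∀ (u : ℝ → E3 → E3) (p : ℝ → E3 → ℝ),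
    IsMaximalSmoothSolution ν 0 u p T → IsLerayHopfOn T ν 0 (u 0) u → HasRapidSpatialDecay (u 0) →
    ∀ M : ℝ, OneLevelTop.HasTypeIConstant ν T M u →
      ∃ (θ A a : ℝ) (d : E3), 0 ≤ θ ∧ (0 < θ ∨ d ≠ 0) ∧ 0 < a ∧
        ∃ᶠ t in 𝓝[<] T, ∀ x ∈ TwoTimeTop.topSet ν T u SnapshotTop.snapLevel t, EchoPocketAt ν T u θ d A a (echoLevel M SnapshotTop.snapLevel θ d A a) t x

/-- **The split**: echo row (proved) + residual ⇒ row F1 (target BY NAME). -/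
theorem rowF1_of_echoCollapse (hR : EchoCollapse) : ScenarioCensus.Row_F1 := by
  unfold ScenarioCensus.Row_F1
  intro ν T hν hT u p hsol hLH hdec hTI
  by_contra hext
  obtain ⟨M, hM⟩ := OneLevelTop.exists_hasTypeIConstant hν hTI
  obtain ⟨θ, A, a, d, hθ, hnd, ha, hfreq⟩ := hR ν T hν hT u p ⟨hsol, hext⟩ hLH hdec M hM
  exact hext (echoLevel_spec hθ hnd ha ν T hν hT u p hsol hLH hdec hM hfreq)

/-- The residual is a consequence of row F1 (vacuously). -/
theorem echoCollapse_of_rowF1 (h : ScenarioCensus.Row_F1) : EchoCollapse :=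
  fun ν T hν hT u p hmax hLH hdec _ hM =>
    (hmax.2 (h ν T hν hT u p hmax.1 hLH hdec hM.isTypeIBlowup)).elim

/-- The residual `EchoCollapse` is EXACTLY `Row_F1`. -/
theorem echoCollapse_iff_rowF1 : EchoCollapse ↔ ScenarioCensus.Row_F1 :=
  ⟨rowF1_of_echoCollapse, echoCollapse_of_rowF1⟩

/-! ### What the echo hypotheses admit (hypothesis level): NOTHING is asked to be small.  A time-independent flow echoes with every
lag (`d = 0`); a spatially `ℓd`-periodic snapshot echoes with `θ = 0`; a signal that is `θ(T − t)`-periodic in time at `x` is a point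
echo — at ANY speed.  (The uniform stream satisfies all of them exactly, as it satisfies LINE 38's balanced stars: an echo is a MASS-ZERO
read-out.  The difference is on the limit side: the exact echo relation has NO non-trivial solution in `𝒦_M` (§4), whereas a balanced
star relation along rays has.)  Conversely a REST window (LINE 35's cell: the fast point was slow throughout a longer window) is a
(degenerate) point echo. -/

/-- A flow that is time-independent on the pocket's two instants echoes with drift `0`, any lag, accuracy `0`. -/
theorem echoPocketAt_of_steady {ν T : ℝ} {u : ℝ → E3 → E3} {θ A a t : ℝ} {x : E3} (hA : 0 ≤ A)
    (hsteady : ∀ y : E3, u (t - θ * (T - t)) y = u t y) : EchoPocketAt ν T u θ 0 A a 0 t x := by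
  refine ⟨x, by simp [sub_self]; positivity, fun y _ => ?_⟩
  rw [smul_zero, add_zero, hsteady y, sub_self, norm_zero, mul_zero, zero_mul]

/-- A snapshot that is `ℓd`-periodic echoes with lag `0`, accuracy `0`. -/
theorem echoPocketAt_of_periodic {ν T : ℝ} {u : ℝ → E3 → E3} {A a t : ℝ} {d x : E3} (hA : 0 ≤ A)
    (hper : ∀ y : E3, u t (y + (Real.sqrt (ν * (T - t))) • d) = u t y) : EchoPocketAt ν T u 0 d A a 0 t x := by
  refine ⟨x, by simp [sub_self]; positivity, fun y _ => ?_⟩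
  rw [zero_mul, sub_zero, hper y, sub_self, norm_zero, mul_zero, zero_mul]

/-- A signal at `x` that is `θ(T − t)`-periodic in time is a point echo of accuracy `0` on every window. -/
theorem pointEchoAt_of_timePeriodic {ν T : ℝ} {u : ℝ → E3 → E3} {θ δ t : ℝ} {x : E3}
    (hper : ∀ τ : ℝ, u (τ - θ * (T - t)) x = u τ x) : PointEchoAt ν T u θ δ 0 t x := by
  intro τ _
  rw [hper τ, sub_self, norm_zero, mul_zero, zero_mul]

/-- The uniform stream `u ≡ v` (fast everywhere when `|v|` is large) echoes exactly, for every lag and drift: the read-out is mass-zero. -/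
theorem echoPocketAt_const {ν T : ℝ} (v : E3) {θ A a t : ℝ} {d x : E3} (hA : 0 ≤ A) :
    EchoPocketAt ν T (fun _ _ => v) θ d A a 0 t x :=
  ⟨x, by simp [sub_self]; positivity, fun y _ => by simp⟩

/-- **A rest window is a point echo**: if the fast point `x` was `ε/2`-slow throughout the longer window `[t − (δ + θ)(T − t), t]`, then it
`ε`-echoes itself with lag `θ(T − t)` on `[t − δ(T − t), t]` (the increment of two small vectors).  So `Row_F1ew` contains the rest-window
cell as the degenerate member. -/
theorem pointEchoAt_of_restWindow {ν T : ℝ} {u : ℝ → E3 → E3} {θ δ ε t : ℝ} {x : E3} (hθ : 0 ≤ θ) (htT : t ≤ T)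
    (hrest : ∀ τ ∈ Icc (t - (δ + θ) * (T - t)) t, Real.sqrt (T - t) * ‖u τ x‖ ≤ ε / 2 * Real.sqrt ν) :
    PointEchoAt ν T u θ δ ε t x := by
  intro τ hτ
  have hTt : 0 ≤ T - t := sub_nonneg.2 htT
  have h1 : τ ∈ Icc (t - (δ + θ) * (T - t)) t := ⟨by nlinarith [hτ.1], hτ.2⟩
  have h2 : τ - θ * (T - t) ∈ Icc (t - (δ + θ) * (T - t)) t := ⟨by nlinarith [hτ.1], by nlinarith [hτ.2]⟩
  have hsq : 0 ≤ Real.sqrt (T - t) := Real.sqrt_nonneg _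
  calc Real.sqrt (T - t) * ‖u τ x - u (τ - θ * (T - t)) x‖
      ≤ Real.sqrt (T - t) * (‖u τ x‖ + ‖u (τ - θ * (T - t)) x‖) :=
        mul_le_mul_of_nonneg_left (norm_sub_le _ _) hsq
    _ = Real.sqrt (T - t) * ‖u τ x‖ + Real.sqrt (T - t) * ‖u (τ - θ * (T - t)) x‖ := by ring
    _ ≤ ε / 2 * Real.sqrt ν + ε / 2 * Real.sqrt ν := add_le_add (hrest τ h1) (hrest _ h2)
    _ = ε * Real.sqrt ν := by ring

/-- Monotonicity of the echo read-out in the threshold (bookkeeping for instrument rows). -/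
theorem echoPocketAt_mono {ν T : ℝ} {u : ℝ → E3 → E3} {θ : ℝ} {d : E3} {A a ε ε' t : ℝ} {x : E3} (hle : ε ≤ ε')
    (hν : 0 ≤ Real.sqrt ν) (h : EchoPocketAt ν T u θ d A a ε t x) : EchoPocketAt ν T u θ d A a ε' t x := by
  obtain ⟨z, hz, hcalm⟩ := h
  exact ⟨z, hz, fun y hy => (hcalm y hy).trans (mul_le_mul_of_nonneg_right hle hν)⟩

/-! ## §7 Summary -/

/-- **LINE 39 «echo-top», summary.**  In kernel, standard axioms: the two FLOORS (universal over fast points, every level `Λ`), the two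
census ROWS, and the declared residual `EchoCollapse ↔ Row_F1`. -/
theorem echoTop_summary :
    EchoFloor ∧ PointEchoFloor ∧ Row_F1ep ∧ Row_F1ew ∧ (EchoCollapse ↔ ScenarioCensus.Row_F1) :=
  ⟨echoFloor_holds, pointEchoFloor_holds, rowF1ep_holds, rowF1ew_holds, echoCollapse_iff_rowF1⟩

end Summit.NavierStokesRegularity.NavierStokesRegularity.Theorems.ScenarioCensus.EchoTop

namespace Summit.NavierStokesRegularity.NavierStokesRegularity.Theorems.ScenarioCensus

/-! ## Census KEYS (ns `…Theorems.ScenarioCensus`): the ECHO members of row F1 (LINE 39) — TREE-decided F1ep / F1ew and floors EF / PEF -/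

/-- **Cell F1ep** (ECHO-POCKET SNAPSHOTS: Type I with constant `M` · for a lag `θ ≥ 0` and drift `d` with `(θ, d) ≠ (0, 0)`, along some `t_k ↑ T` every `c_S`-fast point has an `ε`-echo pocket ⇒ smooth extension past `T`): `:= EchoTop.Row_F1ep`. DECIDED. -/
def Row_F1ep : Prop := EchoTop.Row_F1ep
/-- F1ep is EXCLUDED (decided in the tree): `EchoTop.rowF1ep_holds`. -/
theorem row_F1ep_excluded : Row_F1ep := EchoTop.rowF1ep_holds

/-- **Cell F1ew** (POINT ECHOES ON A WINDOW: every `c_S`-fast point `ε`-echoes itself with lag `θ(T − t_k)` throughout `[t_k − δ(T − t_k), t_k]` along some `t_k ↑ T` ⇒ extension): `:= EchoTop.Row_F1ew`. DECIDED. -/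
def Row_F1ew : Prop := EchoTop.Row_F1ew
/-- F1ew is EXCLUDED (decided in the tree): `EchoTop.rowF1ew_holds`. -/
theorem row_F1ew_excluded : Row_F1ew := EchoTop.rowF1ew_holds

/-- **Floor EF — the ECHO floor** (universal over fast points, every level; no maximality hypothesis): `EchoTop.echoFloor_holds`. -/
theorem row_F1_echoFloor : EchoTop.EchoFloor := EchoTop.echoFloor_holds
/-- **Floor PEF — the POINT-ECHO floor**: `EchoTop.pointEchoFloor_holds`. -/
theorem row_F1_pointEchoFloor : EchoTop.PointEchoFloor := EchoTop.pointEchoFloor_holds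

end Summit.NavierStokesRegularity.NavierStokesRegularity.Theorems.ScenarioCensus

end
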